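import Mathlib.CategoryTheory.PathCategory.Basic
import Mathlib.CategoryTheory.Groupoid.FreeGroupoid
import Mathlib.CategoryTheory.Groupoid.VertexGroup
import Mathlib.GroupTheory.FreeGroup.IsFreeGroup
import Mathlib.GroupTheory.Finiteness
import Literature.AnabelianGeometry.SemiGraphs.SemiGraph

/-!
# `Cat(𝔾)` and the fundamental group of a semi-graph ([SemiAnbd] §2 p. 32; §1 pp. 14–20)

Mochizuki, *Semi-graphs of anabelioids*, Publ. RIMS **42** (2006) 221–322
[cite: MochizukiSemiAnbd2006, Def. 2.11 p.32]:

* p. 32: "any semi-graph `𝔾` may be regarded as a category `Cat(𝔾)`: the objects are the components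
  [vertices and edges] of `𝔾`; the morphisms are the identity morphisms of the components and the
  branches of edges [`b : e → v` if the branch `b` of `e` abuts to `v`]" — realised as the path
  category (Mathlib `Paths`) of the quiver `catQuiver` with one arrow `e → v` per abutting branch
  (all paths have length `≤ 1`, there being no arrow out of a vertex);
* the *(topological) fundamental group* `π₁(𝔾, c)` used throughout §1 (pp. 14–20: "induced morphism
  on (topological) fundamental groups", universal graph-coverings, `π₁(H_1) = ℤ`) — rendered
  combinatorially as the vertex group at `c` of Mathlib's free groupoid on `catQuiver` (the free
  groupoid of this quiver is the fundamental groupoid of the topological space of pp. 11–12: the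
  quiver is its barycentric subdivision with the contractible non-abutting half-edges omitted); a
  morphism of semi-graphs induces a prefunctor, hence homomorphisms of fundamental groups;
* Corollary 1.6 (i) (A. Tamagawa): "there exists an immersion of finite graphs `φ : G_A → G_B` whose
  induced morphism on (topological) fundamental groups is isomorphic to the inclusion `F ↪ G`" —
  NAMED FACT.

Deliberately NOT here: universal graph-coverings as objects (p. 15), van Kampen / freeness of `π₁`
of a graph (not printed as claims).
-/

namespace Literature.AnabelianGeometry.SemiGraphs

namespace SemiGraph

open CategoryTheory

universe u

variable (G : SemiGraph.{u})

/-! ### `Cat(𝔾)` (p. 32) -/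

/-- The components of `𝔾` as the objects of `Cat(𝔾)` / vertices of its generating quiver.
[cite: MochizukiSemiAnbd2006, Def. 2.11 p.32] -/
def CatCarrier : Type u := G.Vertex ⊕ G.Edge

variable {G} in
/-- The arrows generating `Cat(𝔾)`: a branch `b` of `e` abutting to `v` is an arrow `e → v`; no other
non-identity arrows (p. 32). [cite: MochizukiSemiAnbd2006, Def. 2.11 p.32] -/
def CatArrow : G.CatCarrier → G.CatCarrier → Type u
  | Sum.inr e, Sum.inl v => {b : G.Branch // G.edgeOf b = e ∧ G.abuts b = some v}
  | Sum.inl _, Sum.inl _ => PEmpty.{u + 1}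
  | Sum.inl _, Sum.inr _ => PEmpty.{u + 1}
  | Sum.inr _, Sum.inr _ => PEmpty.{u + 1}

/-- The quiver underlying `Cat(𝔾)`. [cite: MochizukiSemiAnbd2006, Def. 2.11 p.32] -/
instance catQuiver : Quiver G.CatCarrier where
  Hom := CatArrow

/-- `Cat(𝔾)` (p. 32): "The objects of this category are the components [i.e., vertices and edges] of
`𝔾`.  The morphisms of this category are the identity morphisms of the components and the branches
of edges" — the path category of `catQuiver`. [cite: MochizukiSemiAnbd2006, Def. 2.11 p.32] -/
abbrev Cat : Type u := Paths G.CatCarrier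

variable {G}

/-- The prefunctor `Cat`-carrier map of a morphism of semi-graphs: components to components, an
abutting branch to its image (which abuts to the image vertex). [cite: MochizukiSemiAnbd2006, §1 p.11] -/
def Hom.catPrefunctor {G' : SemiGraph.{u}} (φ : G ⟶ G') : G.CatCarrier ⥤q G'.CatCarrier where
  obj := Sum.map φ.vertexMap φ.edgeMap
  map {x y} f := match x, y, f with
    | Sum.inr _, Sum.inl v, b =>
        (⟨φ.branchMap b.1, by rw [φ.edgeOf_branchMap, b.2.1], φ.abuts_branchMap b.1 v b.2.2⟩ :
          CatArrow (Sum.inr _) (Sum.inl _))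
    | Sum.inl _, Sum.inl _, f => PEmpty.elim f
    | Sum.inl _, Sum.inr _, f => PEmpty.elim f
    | Sum.inr _, Sum.inr _, f => PEmpty.elim f

/-! ### The fundamental group (pp. 14–20) -/

variable (G)

/-- The *fundamental groupoid* of the semi-graph `𝔾`: the free groupoid on `catQuiver` (the
fundamental groupoid of the associated topological space, pp. 11–12, 14).
[cite: MochizukiSemiAnbd2006, §1 p.14] -/
abbrev FundamentalGroupoid : Type u := Quiver.FreeGroupoid G.CatCarrier

/-- The object of the fundamental groupoid at a component. [cite: MochizukiSemiAnbd2006, §1 p.14] -/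
abbrev basept (c : G.CatCarrier) : G.FundamentalGroupoid :=
  (Quiver.FreeGroupoid.of G.CatCarrier).obj c

/-- The *(topological) fundamental group* `π₁(𝔾, c)` of a semi-graph at a component `c` (pp. 14–20),
as the vertex group of the fundamental groupoid. [cite: MochizukiSemiAnbd2006, §1 p.14] -/
abbrev FundamentalGroup (c : G.CatCarrier) : Type u := G.basept c ⟶ G.basept c

variable {G}

/-- The functor of fundamental groupoids induced by a morphism of semi-graphs.
[cite: MochizukiSemiAnbd2006, §1 p.15] -/
noncomputable def Hom.mapFundamentalGroupoid {G' : SemiGraph.{u}} (φ : G ⟶ G') :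
    G.FundamentalGroupoid ⥤ G'.FundamentalGroupoid :=
  Quiver.freeGroupoidFunctor (Hom.catPrefunctor φ)

/-- "the induced morphism on (topological) fundamental groups" of a morphism of semi-graphs
(Cor. 1.6 (i), p. 19; p. 15), at a component `c`. [cite: MochizukiSemiAnbd2006, Cor. 1.6(i) p.19] -/
noncomputable def Hom.mapFundamentalGroup {G' : SemiGraph.{u}} (φ : G ⟶ G') (c : G.CatCarrier) :
    G.FundamentalGroup c →* ((Hom.mapFundamentalGroupoid φ).obj (G.basept c) ⟶
      (Hom.mapFundamentalGroupoid φ).obj (G.basept c)) :=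
  (Hom.mapFundamentalGroupoid φ).mapVertexGroup (G.basept c)

/-- NAMED FACT, [SemiAnbd] Corollary 1.6 (i) (A. Tamagawa): for a finitely generated subgroup `F` of
a free group `G` of finite rank, "there exists an immersion of finite graphs `φ : G_A → G_B` whose
induced morphism on (topological) fundamental groups is isomorphic to the inclusion `F ↪ G`."
[cite: MochizukiSemiAnbd2006, Cor. 1.6(i) p.19] -/
def corollary_1_6_i : Prop :=
  ∀ (Γ : Type u) [Group Γ] (ι : Type u) [Finite ι] (_bΓ : FreeGroupBasis ι Γ) (F : Subgroup Γ),
    F.FG → ∃ (A B : SemiGraph.{u}) (φ : A ⟶ B) (a : A.Vertex)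
      (eA : A.FundamentalGroup (Sum.inl a) ≃* F)
      (eB : ((Hom.mapFundamentalGroupoid φ).obj (A.basept (Sum.inl a)) ⟶
        (Hom.mapFundamentalGroupoid φ).obj (A.basept (Sum.inl a))) ≃* Γ),
      A.IsFinite ∧ A.IsGraph ∧ B.IsFinite ∧ B.IsGraph ∧ IsImmersion φ ∧
        ∀ x, (eB (Hom.mapFundamentalGroup φ (Sum.inl a) x) : Γ) = (eA x : Γ)

end SemiGraph

end Literature.AnabelianGeometry.SemiGraphs
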